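import Literature.MathematicalPhysics.QuantumFieldTheory.Balaban1983to89.B9Eq3126H1kTwoBackgroundLetterTower
import Literature.MathematicalPhysics.QuantumFieldTheory.Balaban1983to89.B9Eq3126H1kTwoBackgroundGradientLetterTower

/-!
# `Balaban1983to89.B9Eq3126H1kTwoBackgroundSupRowsTower` — T. Bałaban, *Propagators for lattice gauge theories in a background field*, Commun. Math. Phys. **99** (1985) 389–434
# [Balaban1985BackgroundPropagators] (3.126) p. 420 *«HB = GQ*(QGQ*)⁻¹B»*, (3.133) p. 422, Thm 3.4 p. 400 (*«… small perturbations of the operators depending on U only»*), (3.47)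
# p. 398, with [Balaban1985Variational] (45) p. 285, (103) p. 293, (117) p. 295: **THE `H₁,k`-STOREY OF THE TWO-BACKGROUND LADDERS, GLOBAL FORM — the sup rows of
# `H₁,k(U) − H₁,k(1)` and of `∇_1(H₁,k(U) − H₁,k(1))` for EVERY coarse-bond field, `≤ K·α·‖z‖_∞`, constants BEFORE `n, η, m, U`** = the HEIGHT-FREE pair `(B₀, B₁) = (Kα, Kα)`
# of the OWNER's socket `B11Eq117ReadLettersBridge.norm_H1CLM_le_of_global` for the block letter `H₁ := H₁,k(U) − H₁,k(1)` read at the flat gradient — the lattice-free form of the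
# `H`-letter defect `δ_A` of ne9-leaf-04's `B11Eq117LetterDefectsTowerTwoBackgrounds` at the flat point

statement-level skeleton of published theorems with citation tags; proofs where landed; nothing here is a claim about the Yang–Mills mass gap

CITATION HEADER (lean-in-tree rule).  Audit cell `pub-balaban`, sub-cell `t4`, BINDER row NE9; filed by NE9 crux-team LEAF PROVER 01 (`b2b-balaban-t4-ne9-formalise-leaf-01`, gen 101;
ROUTE (J′), the `H₁` storey; bears_on: R4/N22).  Composition BY NAME: this lineage's gen-101 `B9Eq3126H1kTwoBackgroundLetterTower.exists_letter_H1k_sub_flat` (value letter) and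
`B9Eq3126H1kTwoBackgroundGradientLetterTower.exists_gradLetter_H1k_sub_flat` (flat-gradient letter); ne9-leaf-01's `B9Eq349BlockMultipliers.{exists_block_clm_family, sum_block_apply}`;
`B4Sect5Torus.torusSum_le`.  Source READ first-hand in the held text layer `paper:balaban1985-cmp99-background-propagators` (journal page = PDF page + 388) pp. 420, 422, 400, 398.
NOTHING of print's proofs is reproduced: [folklore] block decomposition of the source over the coarse base points + one lattice sum.

WHAT IS PROVED (sorry-free; proof lane — 0 `def`; [folklore]).
* **`exists_supRows_H1k_sub_flat`** — `∃ α₀ > 0, K ≥ 0` BEFORE the bond storey's binder block `+ hαL`; conclusion: the CONJUNCTION of the two socket hypotheses for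
  `H₁ := H₁,k(U) − H₁,k(1)` (a difference of linear maps `BondL2K(coarse, c₁) → BondL2K(fine, c₀)`): for every `z` with `‖z(c′)‖ ≤ M` (`0 ≤ M`), every fine bond `b` and every
  `p = (b, μ)`: `‖((H₁,k(U) − H₁,k(1))z)(b)‖ ≤ K·α·M` and `‖covGrad η⁻¹ (Ad 1) ((H₁,k(U) − H₁,k(1))z) p‖ ≤ K·α·M`.
HONEST SCOPE.  Composition BY NAME on the cell's MODEL rows (O-NE9-1, #5 UNRULED); constants crude (NOT print's `B₀`); flat base only; first order; the smallness windows of `U`, unitarity, the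
tower data, `hαL`, the positivity witnesses at `U` and at `1` stay HYPOTHESES; nothing of [B9] (3.133) ∕ Thm 3.4 or [B11] (45)∕(117) asserted as printed; «NE9 ⇐ the named binders»; NE9 NOT
PRINTED ∕ NOT PROVED; spine PROVED 0∕9; rung (B)+1 on a finite T⁴ — NOT infinite volume, NOT mass gap, NOT BetaPertH, NOT Clay.  HONEST DEPENDENCY: continuum YM on T⁴ ⇐ BetaPertH ∧ nine
spine estimates (0/9 proved); BetaPertH ⇐ (D1) ∧ (D4) ∧ CAP+tail; G-an2-4 gates asym, D1 and NE2/3/4.  NEW file; nothing modified.  Net new unproved facts: 0.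
-/

noncomputable section

open scoped InnerProductSpace ComplexConjugate BigOperators

namespace Literature.MathematicalPhysics.QuantumFieldTheory.Balaban1983to89.B9Eq3126H1kTwoBackgroundSupRowsTower

open B4Sect5Torus (TSite tdist tdist_nonneg torusSum_le)
open B4Sect5Proof (latticeConst latticeConst_nonneg)
open B9SectCLatticeCarrier (Bond bpos btgt shift unshift)
open B9Eq311L2Pairing (WL2)
open B9Eq319QprimeTorus (blockCoord)
open B7Prop1Explicit (U1 Wcx boxVec)
open B11Eq103H1Complex (SiteL2K BondL2K)
open B9Eq33CovDerivVector (covGrad)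
open B9Eq310DeltaPrime (plaqHolU)
open B9Eq310HessianOperator (adTransportW)
open B9Eq315QTorus (perCfg cornerSite)
open B9Eq315QTower (towerP UlevOf)
open B9Eq315QTowerFlat (perCfg_UlevOf_one_mem_U1 norm_Wcx_UlevOf_one_sub_one_le)
open B9Eq316TowerFlatIsOneStep (towerP_eq_fineP_pow siteCast)
open B9Eq326OperatorTower (laplaceAk H1k)
open B9Eq324DeltaPrimeATower (laplacePrimeAk)
open B9Eq349BlockMultipliers (exists_block_clm_family sum_block_apply)
open B9Eq3126H1kTwoBackgroundLetterTower (exists_letter_H1k_sub_flat)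
open B9Eq3126H1kTwoBackgroundGradientLetterTower (exists_gradLetter_H1k_sub_flat)

variable {d : ℕ} (hd : 1 ≤ d) (L : ℕ) [NeZero L] (hL : 1 ≤ L) (hL3 : 3 ≤ L)
  {𝔸 : Type*} [NormedRing 𝔸] [NormedAlgebra ℂ 𝔸] [CompleteSpace 𝔸] [NormOneClass 𝔸] [StarRing 𝔸] [NormedStarGroup 𝔸] [StarModule ℂ 𝔸] [FiniteDimensional ℂ 𝔸]
  {W : Type*} [NormedAddCommGroup W] [InnerProductSpace ℂ W] [FiniteDimensional ℂ W] (φ : W ≃ₗ[ℂ] 𝔸)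
  {Mφ Mφ' : ℝ} (hMφ : 0 ≤ Mφ) (hMφ' : 0 ≤ Mφ') (hφ : ∀ w, ‖φ w‖ ≤ Mφ * ‖w‖) (hφ' : ∀ X, ‖φ.symm X‖ ≤ Mφ' * ‖X‖) (hstar : ∀ X : 𝔸, ‖star X‖ ≤ ‖X‖)
  {a : ℝ} (ha : 0 < a) {a' : ℝ} (ha' : 0 < a') {r : ℝ} (hr0 : 0 ≤ r) (hr1 : r < 1)
  (τ : 𝔸 →ₗ[ℂ] ℂ) {Cτ : ℝ} (hτ : ∀ X, ‖τ X‖ ≤ Cτ * ‖X‖) (hCτ : 0 ≤ Cτ) {Mτ : ℝ} (hτm : ∀ X Y : 𝔸, ‖τ (X * Y)‖ ≤ Mτ * ‖X‖ * ‖Y‖) (hMτ : 0 ≤ Mτ)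
  {ρw : ℝ} (hρw : 0 ≤ ρw)
  (hτ₁ : ∀ X : 𝔸, τ (star X) = conj (τ X)) (hτ₂ : ∀ X Y : 𝔸, τ (X * Y) = τ (Y * X)) (hφτ : ∀ X Y : 𝔸, ⟪φ.symm X, φ.symm Y⟫_ℂ = τ (star X * Y))
  {ι : Type} [Fintype ι] [DecidableEq ι] (b : Module.Basis ι ℝ 𝔸) {M₂ : ℝ} (hM₂ : 0 ≤ M₂) (hrepr : ∀ (v : 𝔸) (i : ι), |b.repr v i| ≤ M₂ * ‖v‖)
  (AQ : ℝ)

/-! ## The global sup rows of `H₁,k(U) − H₁,k(1)` (value and flat gradient), lattice-free -/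

include hd hL hL3 hMφ hMφ' hφ hφ' hstar ha ha' hr0 hr1 hτ hCτ hτm hMτ hρw hτ₁ hτ₂ hφτ hM₂ hrepr in
set_option maxHeartbeats 3200000 in
set_option maxRecDepth 8192 in
/-- **THE `H₁,k`-STOREY, GLOBAL FORM** — see the module docstring: for every coarse-bond field `z` with `‖z(c′)‖ ≤ M`, `‖((H₁,k(U) − H₁,k(1))z)(b)‖ ≤ K·α·M` and
`‖(∇_1(H₁,k(U) − H₁,k(1))z)(b, μ)‖ ≤ K·α·M`, constants before the lattice — the `(hT, hDT)` pair of `B11Eq117ReadLettersBridge.norm_H1CLM_le_of_global` for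
`H₁ := H₁,k(U) − H₁,k(1)` at the flat gradient. [folklore]
[cite: Balaban1985BackgroundPropagators, (3.126) p.420, (3.133) p.422, Thm 3.4 p.400, (3.47) p.398; Balaban1985Variational, (45) p.285, (103) p.293, (117) p.295] -/
theorem exists_supRows_H1k_sub_flat :
    ∃ α₀ K : ℝ, 0 < α₀ ∧ 0 ≤ K ∧
      ∀ (n : ℕ) (η : ℝ), η * (L : ℝ) ^ (n + 1) = 1 →
      ∀ (c₀ c₁ : ℝ) [Fact (0 < c₀)] [Fact (0 < c₁)], c₀ * ((L : ℝ) ^ (n + 1)) ^ d = c₁ → |η| ^ d / c₀ ≤ ρw →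
      ∀ (m : Fin d → ℕ) [∀ i, NeZero (m i)], (∀ i, 1 ≤ m i) → ∀ (U : Bond d (towerP L m (n + 1)) → 𝔸ˣ) (α : ℝ), 0 ≤ α → α ≤ α₀ →
        (∀ bd, U bd ∈ U1 𝔸) → (∀ bd, ‖(U bd : 𝔸) - 1‖ ≤ α * η) →
        (∀ (x : TSite d (towerP L m (n + 1))) (μ ν : Fin d), ‖(U (shift ν x, μ) : 𝔸) - (U (x, μ) : 𝔸)‖ ≤ α * η ^ 2) →
        (∀ p : B9SectCLatticeCarrier.Plaq d (towerP L m (n + 1)), ‖(plaqHolU U p : 𝔸) - 1‖ ≤ α * η ^ 2) →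
      ∀ (hUst : ∀ bd, star (U bd : 𝔸) = (((U bd)⁻¹ : 𝔸ˣ) : 𝔸))
        (αU : ℕ → ℝ), (∀ j, 0 ≤ αU j) → ∀ (hα1 : ∀ j, αU j ≤ 1 / 64), ∀ (hαL : ∀ j, 50 * (d + 1) * αU j * (L : ℝ) ^ d ≤ 1 / 2),
        (∑ j ∈ Finset.range (n + 1), αU j ≤ AQ) →
        ∀ (hU1 : ∀ (j : ℕ) (x : B7Prop1Explicit.Site d) (k : Fin d), perCfg (towerP L m (j + 1)) (UlevOf L m (n + 1) U j) x k ∈ U1 𝔸)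
        (hreg : ∀ (j : ℕ) (y : TSite d (towerP L m j)) (k : Fin d) (ρ' : Fin d → Fin L),
          ‖((Wcx L (perCfg (towerP L m (j + 1)) (UlevOf L m (n + 1) U j)) (cornerSite L y) k (boxVec L ρ') : 𝔸ˣ) : 𝔸) - 1‖ ≤ αU j),
      ∀ (εU : ℕ → ℝ), (∀ j, 0 ≤ εU j) → (∀ j, εU j ≤ 1) → (∀ j < n + 1, εU j ≤ α * r ^ j) →
        (∀ (j : ℕ) (bd : Bond d (towerP L m (j + 1))), ‖(UlevOf L m (n + 1) U j bd : 𝔸) - 1‖ ≤ εU j) →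
        (∀ (j : ℕ) (bd : Bond d (towerP L m (j + 1))), UlevOf L m (n + 1) U j bd ∈ U1 𝔸) →
        (∀ (j : ℕ) (bd : Bond d (towerP L m (j + 1))) (w : W), ‖adTransportW φ (UlevOf L m (n + 1) U j) bd w‖ ≤ ‖w‖) →
      ∀ (hposU' : ∀ x : SiteL2K ℂ d (towerP L m (n + 1)) c₀ W, x ≠ 0 → 0 < RCLike.re ⟪x, laplacePrimeAk L m n φ η U a' (c₁ := c₁) x⟫_ℂ)
        (hposU : ∀ x : BondL2K ℂ d (towerP L m (n + 1)) c₀ W, x ≠ 0 →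
          0 < RCLike.re ⟪x, laplaceAk L m n φ η U hL αU hα1 hU1 hreg τ (c₀ := c₀) (c₁ := c₁) a x⟫_ℂ)
        (hpos'₁ : ∀ x : SiteL2K ℂ d (towerP L m (n + 1)) c₀ W, x ≠ 0 →
          0 < RCLike.re ⟪x, laplacePrimeAk L m n φ η (fun _ : Bond d (towerP L m (n + 1)) => (1 : 𝔸ˣ)) a' (c₁ := c₁) x⟫_ℂ)
        (hpos₁ : ∀ x : BondL2K ℂ d (towerP L m (n + 1)) c₀ W, x ≠ 0 →
          0 < RCLike.re ⟪x, laplaceAk L m n φ η (fun _ : Bond d (towerP L m (n + 1)) => (1 : 𝔸ˣ)) hL (fun _ => 0) (fun _ => by norm_num)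
            (perCfg_UlevOf_one_mem_U1 L m (n + 1)) (norm_Wcx_UlevOf_one_sub_one_le L m (n + 1) (fun _ => 0) (fun _ => le_rfl)) τ
            (c₀ := c₀) (c₁ := c₁) a x⟫_ℂ),
      (∀ (z : BondL2K ℂ d m c₁ W) (M : ℝ), 0 ≤ M → (∀ c', ‖WL2.equiv ℂ (fun _ : Bond d m => c₁) W z c'‖ ≤ M) →
        ∀ bd : Bond d (towerP L m (n + 1)),
          ‖WL2.equiv ℂ (fun _ : Bond d (towerP L m (n + 1)) => c₀) W
              ((H1k L m n φ η U hL αU hα1 hU1 hreg τ (c₀ := c₀) (c₁ := c₁) hαL hposU -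
                H1k L m n φ η (fun _ : Bond d (towerP L m (n + 1)) => (1 : 𝔸ˣ)) hL (fun _ => 0) (fun _ => by norm_num)
                (perCfg_UlevOf_one_mem_U1 L m (n + 1)) (norm_Wcx_UlevOf_one_sub_one_le L m (n + 1) (fun _ => 0) (fun _ => le_rfl)) τ (c₀ := c₀) (c₁ := c₁)
                (fun _ => by norm_num) hpos₁) z) bd‖ ≤ K * α * M) ∧
      (∀ (z : BondL2K ℂ d m c₁ W) (M : ℝ), 0 ≤ M → (∀ c', ‖WL2.equiv ℂ (fun _ : Bond d m => c₁) W z c'‖ ≤ M) →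
        ∀ p : Bond d (towerP L m (n + 1)) × Fin d,
          ‖covGrad ((η : ℂ))⁻¹ (adTransportW φ (fun _ : Bond d (towerP L m (n + 1)) => (1 : 𝔸ˣ)))
              (WL2.equiv ℂ (fun _ : Bond d (towerP L m (n + 1)) => c₀) W
                ((H1k L m n φ η U hL αU hα1 hU1 hreg τ (c₀ := c₀) (c₁ := c₁) hαL hposU -
                  H1k L m n φ η (fun _ : Bond d (towerP L m (n + 1)) => (1 : 𝔸ˣ)) hL (fun _ => 0) (fun _ => by norm_num)
                (perCfg_UlevOf_one_mem_U1 L m (n + 1)) (norm_Wcx_UlevOf_one_sub_one_le L m (n + 1) (fun _ => 0) (fun _ => le_rfl)) τ (c₀ := c₀) (c₁ := c₁)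
                (fun _ => by norm_num) hpos₁) z)) p‖ ≤ K * α * M) := by
  classical
  obtain ⟨αV, KV, κV, hαV, hKV, hκV, HV⟩ :=
    exists_letter_H1k_sub_flat hd L hL hL3 φ hMφ hMφ' hφ hφ' hstar ha ha' hr0 hr1 τ hτ hCτ hτm hMτ hρw hτ₁ hτ₂ hφτ b hM₂ hrepr AQ
  obtain ⟨αG, KG, κG, hαG, hKG, hκG, HG⟩ :=
    exists_gradLetter_H1k_sub_flat hd L hL hL3 φ hMφ hMφ' hφ hφ' hstar ha ha' hr0 hr1 τ hτ hCτ hτm hMτ hρw hτ₁ hτ₂ hφτ b hM₂ hrepr AQ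
  set SV : ℝ := latticeConst d κV with hSV
  set SG : ℝ := latticeConst d κG with hSG
  have hSV0 : 0 ≤ SV := latticeConst_nonneg d hκV.le
  have hSG0 : 0 ≤ SG := latticeConst_nonneg d hκG.le
  refine ⟨min αV αG, KV * SV + KG * SG, lt_min hαV hαG, by positivity, ?_⟩
  intro n η hηL c₀ c₁ _ _ hw hρ m _ hm U α hα hαle hUb hUη hUw hpl hUst αU hα0U hα1 hαL hAQ hU1 hreg εU hε0 hε1 hεr hlev hlev1 hRlev hposU' hposU hpos'₁ hpos₁
  have hαV' : α ≤ αV := hαle.trans (min_le_left _ _)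
  have hαG' : α ≤ αG := hαle.trans (min_le_right _ _)
  -- names
  set piS : TSite d (towerP L m (n + 1)) → TSite d m := fun x => blockCoord (L ^ (n + 1)) m (siteCast (towerP_eq_fineP_pow L m (n + 1)) x) with hpiS
  set HU := H1k L m n φ η U hL αU hα1 hU1 hreg τ (c₀ := c₀) (c₁ := c₁) hαL hposU with hHU
  set H1 := H1k L m n φ η (fun _ : Bond d (towerP L m (n + 1)) => (1 : 𝔸ˣ)) hL (fun _ => 0) (fun _ => by norm_num)
                (perCfg_UlevOf_one_mem_U1 L m (n + 1)) (norm_Wcx_UlevOf_one_sub_one_le L m (n + 1) (fun _ => 0) (fun _ => le_rfl)) τ (c₀ := c₀) (c₁ := c₁)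
                (fun _ => by norm_num) hpos₁ with hH1
  -- the block decomposition of the source over the coarse base points
  obtain ⟨P, hP⟩ := exists_block_clm_family (𝕜 := ℂ) (w := fun _ : Bond d m => c₁) (V := W) (fun c' : Bond d m => bpos c')
  have hdec : ∀ z : BondL2K ℂ d m c₁ W, (HU - H1) z = ∑ v, (HU (P v z) - H1 (P v z)) := fun z => by
    conv_lhs => rw [← sum_block_apply hP z]
    rw [LinearMap.sub_apply, map_sum, map_sum, Finset.sum_sub_distrib]
  have hfun : ∀ z : BondL2K ℂ d m c₁ W, WL2.equiv ℂ (fun _ : Bond d (towerP L m (n + 1)) => c₀) W ((HU - H1) z) =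
      ∑ v, WL2.equiv ℂ (fun _ : Bond d (towerP L m (n + 1)) => c₀) W (HU (P v z) - H1 (P v z)) := fun z => by
    rw [hdec]
    have e := map_sum (WL2.linearEquiv ℂ ℂ (fun _ : Bond d (towerP L m (n + 1)) => c₀) (V := W)) (fun v => HU (P v z) - H1 (P v z)) Finset.univ
    simpa only [WL2.linearEquiv_apply] using e
  have hblk : ∀ (z : BondL2K ℂ d m c₁ W) (M : ℝ), 0 ≤ M → (∀ c', ‖WL2.equiv ℂ (fun _ : Bond d m => c₁) W z c'‖ ≤ M) → ∀ v,
      (∀ c', bpos c' ≠ v → WL2.equiv ℂ (fun _ : Bond d m => c₁) W (P v z) c' = 0) ∧ (∀ c', ‖WL2.equiv ℂ (fun _ : Bond d m => c₁) W (P v z) c'‖ ≤ M) := by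
    intro z M hM hzM v
    refine ⟨fun c' hc' => ?_, fun c' => ?_⟩
    · rw [hP, if_neg hc']
    · rw [hP]
      split_ifs
      · exact hzM c'
      · rw [norm_zero]; exact hM
  refine ⟨fun z M hM hzM bd => ?_, fun z M hM hzM p => ?_⟩
  · -- the value row
    rw [hfun, Finset.sum_apply]
    calc ‖∑ v, WL2.equiv ℂ (fun _ : Bond d (towerP L m (n + 1)) => c₀) W (HU (P v z) - H1 (P v z)) bd‖
        ≤ ∑ v, ‖WL2.equiv ℂ (fun _ : Bond d (towerP L m (n + 1)) => c₀) W (HU (P v z) - H1 (P v z)) bd‖ := norm_sum_le _ _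
      _ ≤ ∑ v, KV * α * Real.exp (-(κV * tdist m (piS (bpos bd)) v)) * M := Finset.sum_le_sum fun v _ =>
          HV n η hηL c₀ c₁ hw hρ m hm U α hα hαV' hUb hUη hUw hpl hUst αU hα0U hα1 hαL hAQ hU1 hreg εU hε0 hε1 hεr hlev hlev1 hRlev hposU' hposU hpos'₁ hpos₁
            v (P v z) M (hblk z M hM hzM v).1 (hblk z M hM hzM v).2 bd
      _ = KV * α * M * ∑ v, Real.exp (-(κV * tdist m (piS (bpos bd)) v)) := by
          rw [Finset.mul_sum]; exact Finset.sum_congr rfl fun v _ => by ring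
      _ ≤ KV * α * M * SV := mul_le_mul_of_nonneg_left (torusSum_le d hm hκV (piS (bpos bd))) (by positivity)
      _ ≤ (KV * SV + KG * SG) * α * M := by nlinarith [mul_nonneg (mul_nonneg hKG hSG0) (mul_nonneg hα hM)]
  · -- the flat-gradient row
    obtain ⟨bd, μ⟩ := p
    rw [hfun, map_sum, Finset.sum_apply]
    calc ‖∑ v, covGrad ((η : ℂ))⁻¹ (adTransportW φ (fun _ : Bond d (towerP L m (n + 1)) => (1 : 𝔸ˣ)))
            (WL2.equiv ℂ (fun _ : Bond d (towerP L m (n + 1)) => c₀) W (HU (P v z) - H1 (P v z))) (bd, μ)‖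
        ≤ ∑ v, ‖covGrad ((η : ℂ))⁻¹ (adTransportW φ (fun _ : Bond d (towerP L m (n + 1)) => (1 : 𝔸ˣ)))
            (WL2.equiv ℂ (fun _ : Bond d (towerP L m (n + 1)) => c₀) W (HU (P v z) - H1 (P v z))) (bd, μ)‖ := norm_sum_le _ _
      _ ≤ ∑ v, KG * α * Real.exp (-(κG * tdist m (piS (btgt bd)) v)) * M := Finset.sum_le_sum fun v _ =>
          HG n η hηL c₀ c₁ hw hρ m hm U α hα hαG' hUb hUη hUw hpl hUst αU hα0U hα1 hαL hAQ hU1 hreg εU hε0 hε1 hεr hlev hlev1 hRlev hposU' hposU hpos'₁ hpos₁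
            v (P v z) M (hblk z M hM hzM v).1 (hblk z M hM hzM v).2 μ bd
      _ = KG * α * M * ∑ v, Real.exp (-(κG * tdist m (piS (btgt bd)) v)) := by
          rw [Finset.mul_sum]; exact Finset.sum_congr rfl fun v _ => by ring
      _ ≤ KG * α * M * SG := mul_le_mul_of_nonneg_left (torusSum_le d hm hκG (piS (btgt bd))) (by positivity)
      _ ≤ (KV * SV + KG * SG) * α * M := by nlinarith [mul_nonneg (mul_nonneg hKV hSV0) (mul_nonneg hα hM)]

end Literature.MathematicalPhysics.QuantumFieldTheory.Balaban1983to89.B9Eq3126H1kTwoBackgroundSupRowsTower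

end
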